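import Summits.CriticalPhenomena.SAWScalingLimit.Theorems.SAWDevelopingMapObservableToSLERestrictionCocycleHelpersLattice
import HarnessLib

/-!
# Crux `SAWDevelopingMap.ObservableToSLE` (stmt-CriticalPhenomena-10472), line
`floor-ratio-restriction-bootstrap`: half-strip exhaustion and the tail of the arch series
(towards `stub_halfPlaneArchTightness` at bounded span)

Landing target:
`Summits/CriticalPhenomena/SAWScalingLimit/Theorems/SAWDevelopingMapObservableToSLEHalfPlaneArchTightnessStrips.lean`
(`--supports stmt-CriticalPhenomena-10472`; imports the landed helpers of the line through
`…RestrictionCocycleHelpersLattice.lean`, p76686, for `re_hexMidpoint_floorEdge`).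

The registered anchor stub `stub_halfPlaneArchTightness` asks, for every `ε > 0`, for ONE `K` such that
for ALL spans `n ≥ 1` the `x_c`-mass of the half-plane arches `s → t` (`|mid s - mid t| ≤ n`) of a
finite domain `Λ` above the floor line through `mid s` that reach distance `≥ K n` from `mid s` is at
most `ε · Z_B(s, t)`, `B` the upper half-box of radius `2 K n` — an OPEN uniform estimate.  Its
BOUNDED-SPAN case (`n ≤ N₀`, sibling file `…HalfPlaneArchTightnessBoundedSpan.lean`) is the tail of a
convergent series; this file supplies the series and its tail:

* `mem_halfStrip_iff`, `map_halfStrip`, `halfStrip_mono`, `halfStrip_geometry`,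
  `exists_subset_halfStrip`, `floorUp_mem_halfStrip`: the exhaustion of the upper half-lattice at the
  vertical floor mid-edge `s_x = {(x - e₁, 1), (x, 0)}` by the preimages `S_x(N)` of the
  Duminil-Copin–Smirnov strips `V(S_{N+1,N+1})` under the standard chart at `x`; every vertex of
  `S_x(N)` lies in the rows `≥ x₁` within distance `4N + 4` of `mid s_x`, and every finite `Λ` in the
  rows `≥ x₁` lies in some `S_x(R)`;
* `archMass_halfStrip_eq` (translation invariance): `Z_{S_x(N)}(s_x, t_y)` is a sum over coded walks
  of `S_{N+1,N+1}` depending only on `y₀ - x₀` and `N` (`archMass_eq_sum_midWalks`);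
* **`exists_archThreshold`** (registered as `stub_halfPlaneArchTightness_archThreshold`): for a fixed
  offset `d ≠ 0` these sums increase in `N` to a finite limit (`floorArchMass_le`, the DCS bound
  `≤ 1/cos(3π/8)`), so beyond some `N` every larger strip carries at most `(1 + ε)` times the mass of
  the current one.
-/

noncomputable section

open scoped BigOperators Topology Classical
open Filter Set
open Literature.Probability.LatticeModels (HexVertex hexGraph hexCenter triEmbed triZeta Site
  triZeta_re triZeta_im)
open Literature.Probability.RandomPlanarGeometry
open Literature.Probability.RandomPlanarGeometry.SAW
open Literature.Probability.RandomPlanarGeometry.SAW.HV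
open Literature.Probability.Percolation (hexCenter_im hexCenter_re)

namespace Summit.CriticalPhenomena.SAWScalingLimit.Theorems.ObservableToSLE.FloorRatio

/-! ### The exhaustion of the upper half-lattice by chart preimages of strips -/

/-- Membership in the half-strip `S_x(N) = Φ_x⁻¹(V(S_{N+1,N+1}))`, `Φ_x` the standard chart at the
cell `x`. [cite: DuminilCopinSmirnov2012, §3 (S_{T,L})] -/
theorem mem_halfStrip_iff (x : Site 2) (N : ℕ) (w : HexVertex) :
    w ∈ (stripV (N + 1) (N + 1)).map
        (hvIso.trans (shift (-(x 0)) (-(x 1)))).symm.toEquiv.toEmbedding ↔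
      (hvIso.trans (shift (-(x 0)) (-(x 1)))) w ∈ stripV (N + 1) (N + 1) := by
  rw [Finset.mem_map_equiv]
  exact Iff.rfl

/-- The chart maps the half-strip `S_x(N)` onto `V(S_{N+1,N+1})`. [cite: DuminilCopinSmirnov2012, §3 (S_{T,L})] -/
theorem map_halfStrip (x : Site 2) (N : ℕ) :
    ((stripV (N + 1) (N + 1)).map
        (hvIso.trans (shift (-(x 0)) (-(x 1)))).symm.toEquiv.toEmbedding).map
        (hvIso.trans (shift (-(x 0)) (-(x 1)))).toEquiv.toEmbedding = stripV (N + 1) (N + 1) := by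
  ext v
  rw [Finset.mem_map_equiv, Finset.mem_map_equiv]
  exact iff_of_eq (congrArg (· ∈ _) ((hvIso.trans (shift (-(x 0)) (-(x 1)))).apply_symm_apply v))

/-- The half-strips increase with `N`. [cite: DuminilCopinSmirnov2012, §3 (S_{T,L})] -/
theorem halfStrip_mono (x : Site 2) {N R : ℕ} (h : N ≤ R) :
    (stripV (N + 1) (N + 1)).map (hvIso.trans (shift (-(x 0)) (-(x 1)))).symm.toEquiv.toEmbedding ⊆
      (stripV (R + 1) (R + 1)).map
        (hvIso.trans (shift (-(x 0)) (-(x 1)))).symm.toEquiv.toEmbedding :=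
  Finset.map_subset_map.2 ((stripV_mono_T (by omega)).trans (stripV_mono_L (by omega)))

/-- **Geometry of the half-strips.**  Every vertex of `S_x(N)` lies in the rows `≥ x₁` and within
Euclidean distance `4N + 4` of `mid s_x`. [cite: DuminilCopinSmirnov2012, §3 (S_{T,L})] -/
theorem halfStrip_geometry {x : Site 2} {N : ℕ} {w : HexVertex}
    (hw : w ∈ (stripV (N + 1) (N + 1)).map
        (hvIso.trans (shift (-(x 0)) (-(x 1)))).symm.toEquiv.toEmbedding) :
    x 1 ≤ w.1 1 ∧
      dist (hexCenter w) (hexMidpoint s((x - Pi.single 1 1, 1), (x, 0))) ≤ 4 * N + 4 := by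
  obtain ⟨z, i⟩ := w
  rw [mem_halfStrip_iff, floorChart_apply, mem_stripV_iff] at hw
  have hint : 0 ≤ z 1 - x 1 ∧ z 1 - x 1 ≤ N ∧ -(2 * (N : ℤ) + 2) ≤ z 0 - x 0 ∧
      z 0 - x 0 ≤ N + 1 := by
    fin_cases i <;> simp [bit] at hw <;> omega
  obtain ⟨h1, h2, h3, h4⟩ := hint
  refine ⟨by simpa using h1, ?_⟩
  have r1 : (x 1 : ℝ) ≤ z 1 := by exact_mod_cast (by omega : x 1 ≤ z 1)
  have r2 : (z 1 : ℝ) ≤ x 1 + N := by exact_mod_cast (by omega : z 1 ≤ x 1 + N)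
  have r3 : (x 0 : ℝ) - (2 * N + 2) ≤ z 0 := by
    exact_mod_cast (by omega : x 0 - (2 * (N : ℤ) + 2) ≤ z 0)
  have r4 : (z 0 : ℝ) ≤ x 0 + (N + 1) := by exact_mod_cast (by omega : z 0 ≤ x 0 + (N + 1))
  have hi : (0 : ℝ) ≤ ((i : ℕ) : ℝ) ∧ ((i : ℕ) : ℝ) ≤ 1 := by fin_cases i <;> simp
  have hc0 : (0 : ℝ) < Real.sqrt 3 / 2 := by positivity
  have hc1 : Real.sqrt 3 / 2 ≤ 1 := by
    rw [div_le_one (by norm_num : (0 : ℝ) < 2)]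
    have h4' : Real.sqrt 4 = 2 := by
      rw [show (4 : ℝ) = 2 ^ 2 by norm_num, Real.sqrt_sq (by norm_num)]
    rw [← h4']
    exact Real.sqrt_le_sqrt (by norm_num)
  rw [Complex.dist_eq]
  refine (Complex.norm_le_abs_re_add_abs_im _).trans ?_
  rw [Complex.sub_re, Complex.sub_im, hexCenter_re, hexCenter_im, re_hexMidpoint_floorEdge,
    im_hexMidpoint_floorEdge]
  have hre : |(z 0 : ℝ) + (z 1 : ℝ) / 2 + (((i : ℕ) : ℝ) + 1) / 2 - ((x 0 : ℝ) + (x 1 : ℝ) / 2 + 1 / 2)|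
      ≤ 3 * N + 3 := by
    rw [abs_le]; constructor <;> linarith [hi.1, hi.2]
  have him : |((z 1 : ℝ) + (((i : ℕ) : ℝ) + 1) / 3) * (Real.sqrt 3 / 2) - (x 1 : ℝ) * (Real.sqrt 3 / 2)|
      ≤ N + 1 := by
    have e : ((z 1 : ℝ) + (((i : ℕ) : ℝ) + 1) / 3) * (Real.sqrt 3 / 2) - (x 1 : ℝ) * (Real.sqrt 3 / 2)
        = ((z 1 : ℝ) - x 1 + (((i : ℕ) : ℝ) + 1) / 3) * (Real.sqrt 3 / 2) := by ring
    rw [e, abs_of_nonneg (mul_nonneg (by linarith [hi.1]) hc0.le)]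
    calc ((z 1 : ℝ) - x 1 + (((i : ℕ) : ℝ) + 1) / 3) * (Real.sqrt 3 / 2)
        ≤ ((N : ℝ) + 1) * 1 :=
          mul_le_mul (by linarith [hi.2]) hc1 hc0.le (by positivity)
      _ = N + 1 := mul_one _
  linarith

/-- **Every finite piece of the upper half-lattice lies in a half-strip** `S_x(R)`, `R` as large as
desired. [cite: DuminilCopinSmirnov2012, §3 (S_{T,L})] -/
theorem exists_subset_halfStrip (Λ : Finset HexVertex) (x : Site 2) (hΛ : ∀ v ∈ Λ, x 1 ≤ v.1 1)
    (N₀ : ℕ) :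
    ∃ R : ℕ, N₀ ≤ R ∧ Λ ⊆ (stripV (R + 1) (R + 1)).map
      (hvIso.trans (shift (-(x 0)) (-(x 1)))).symm.toEquiv.toEmbedding := by
  obtain ⟨T, L, -, hsub⟩ := exists_map_subset_stripV Λ x hΛ
  refine ⟨max N₀ (max T L), le_max_left _ _, fun w hw => ?_⟩
  rw [mem_halfStrip_iff]
  have hw' : (hvIso.trans (shift (-(x 0)) (-(x 1)))) w ∈
      Λ.map (hvIso.trans (shift (-(x 0)) (-(x 1)))).toEquiv.toEmbedding :=
    (Finset.mem_map' _).2 hw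
  refine stripV_mono_T (T := T) ?_ (stripV_mono_L (L := L) ?_ (hsub hw'))
  · exact (le_max_left T L).trans ((le_max_right N₀ _).trans (Nat.le_succ _))
  · exact (le_max_right T L).trans ((le_max_right N₀ _).trans (Nat.le_succ _))

/-- The inner endpoint `(y, 0)` of the floor mid-edge `t_y` (`y₁ = x₁`) lies in `S_x(N)` as soon as
`|y₀ - x₀| ≤ N + 1`. [cite: DuminilCopinSmirnov2012, §3 (S_{T,L})] -/
theorem floorUp_mem_halfStrip {x y : Site 2} {N : ℕ} (hy : y 1 = x 1) (hd : |y 0 - x 0| ≤ N + 1) :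
    (y, (0 : Fin 2)) ∈ (stripV (N + 1) (N + 1)).map
      (hvIso.trans (shift (-(x 0)) (-(x 1)))).symm.toEquiv.toEmbedding := by
  rw [mem_halfStrip_iff, floorChart_apply, mem_stripV_iff, hy, sub_self]
  rw [abs_le] at hd
  simp only [Fin.isValue, zero_ne_one, decide_false, lev_mk, bit_false, mul_zero, add_zero,
    le_refl, true_and, sub_zero]
  omega

/-! ### Translation invariance of the half-strip arch masses -/

/-- **`Z_{S_x(N)}(s_x, t_y)` depends only on `y₀ - x₀` and `N`.**  For `y₁ = x₁` and `(y, 0) ∈ S_x(N)`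
the critical mass of the arches `s_x → t_y` inside the half-strip `S_x(N)` is the sum of `x_c^ℓ` over
the coded mid-edge walks of `S_{N+1,N+1}` whose final dart lies on the floor mid-edge at abscissa
`y₀ - x₀`. [cite: DuminilCopinSmirnov2012, §1–§2 (walks between mid-edges)] -/
theorem archMass_halfStrip_eq (x y : Site 2) (N : ℕ) (hy : y 1 = x 1)
    (hy0 : (y, (0 : Fin 2)) ∈ (stripV (N + 1) (N + 1)).map
      (hvIso.trans (shift (-(x 0)) (-(x 1)))).symm.toEquiv.toEmbedding) :
    ∑ γ : HexMidEdgeSAW ((stripV (N + 1) (N + 1)).map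
        (hvIso.trans (shift (-(x 0)) (-(x 1)))).symm.toEquiv.toEmbedding)
        s((x - Pi.single 1 1, 1), (x, 0)) s((y - Pi.single 1 1, 1), (y, 0)),
        hexCriticalFugacity ^ γ.length =
      ∑ P ∈ (midWalks (stripV (N + 1) (N + 1))).filter
          (fun P => finalDart P = ((y 0 - x 0, 0, false), (y 0 - x 0, -1, true)) ∨
            finalDart P = ((y 0 - x 0, -1, true), (y 0 - x 0, 0, false))),
        hexCriticalFugacity ^ mwLen P := by
  set Φ : hexGraph ≃g hvGraph := hvIso.trans (shift (-(x 0)) (-(x 1))) with hΦ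
  set Λ := (stripV (N + 1) (N + 1)).map Φ.symm.toEquiv.toEmbedding with hΛ
  have hmap : Λ.map Φ.toEquiv.toEmbedding = stripV (N + 1) (N + 1) := map_halfStrip x N
  have hx0 : (x, (0 : Fin 2)) ∈ Λ := by
    rw [hΛ, hΦ, mem_halfStrip_iff, floorChart_up]
    exact hvOrigin_mem_stripV (Nat.le_add_left 1 N)
  have hu : (x - Pi.single 1 1, (1 : Fin 2)) ∉ Λ := by
    rw [hΛ, hΦ, mem_halfStrip_iff, floorChart_down]
    exact wOut_not_mem_stripV _ _
  have hΦy : Φ (y, 0) = (y 0 - x 0, 0, false) := by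
    rw [hΦ, floorChart_apply, hy, sub_self]
    rfl
  have hΦy' : Φ (y - Pi.single 1 1, 1) = (y 0 - x 0, -1, true) := by
    rw [hΦ, floorChart_apply]
    simp only [Pi.sub_apply, Pi.single_eq_same, Fin.isValue, decide_true]
    refine Prod.ext ?_ (Prod.ext ?_ rfl)
    · simp
    · show y 1 - 1 - x 1 = -1
      omega
  have e : s((y - Pi.single 1 1, (1 : Fin 2)), (y, (0 : Fin 2))) =
      s((y, (0 : Fin 2)), (y - Pi.single 1 1, (1 : Fin 2))) := Sym2.eq_swap
  rw [e, archMass_eq_sum_midWalks rfl hu hx0 (adj_floorEdge x) (hΦ ▸ floorChart_down x)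
    (hΦ ▸ floorChart_up x) (adj_floorEdge y).symm hy0, hmap, hΦy, hΦy']

/-- The coded floor-arch sums increase with the strip. [cite: DuminilCopinSmirnov2012, §3] -/
theorem hvArchSum_mono (d : ℤ) {R R' : ℕ} (h : R ≤ R') :
    ∑ P ∈ (midWalks (stripV (R + 1) (R + 1))).filter
        (fun P => finalDart P = ((d, 0, false), (d, -1, true)) ∨
          finalDart P = ((d, -1, true), (d, 0, false))), hexCriticalFugacity ^ mwLen P ≤
      ∑ P ∈ (midWalks (stripV (R' + 1) (R' + 1))).filter
        (fun P => finalDart P = ((d, 0, false), (d, -1, true)) ∨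
          finalDart P = ((d, -1, true), (d, 0, false))), hexCriticalFugacity ^ mwLen P := by
  refine Finset.sum_le_sum_of_subset_of_nonneg (fun P hP => ?_)
    fun _ _ _ => pow_nonneg hexCriticalFugacity_pos_lt_one.1.le _
  rw [Finset.mem_filter, mem_midWalks_iff] at hP ⊢
  exact ⟨hP.1.mono ((stripV_mono_T (by omega)).trans (stripV_mono_L (by omega))), hP.2⟩

/-- **The tail of the arch series.**  For a fixed offset `d ≠ 0` the coded floor-arch sums of the
strips `S_{N+1,N+1}` increase in `N` and are bounded by `1/cos(3π/8)` (Duminil-Copin–Smirnov), hence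
converge; so for every `ε > 0` there is a threshold `N` beyond which every larger strip carries at
most `(1 + ε)` times the mass of the current one.
[cite: DuminilCopinSmirnov2012, Lemma 2 and §3 ("A_T ≤ 1/c_α")] -/
theorem exists_archThreshold (d : ℤ) (hd : d ≠ 0) (ε : ℝ) (hε : 0 < ε) :
    ∃ N : ℕ, ∀ N' : ℕ, N ≤ N' → |d| ≤ N' + 1 → ∀ R : ℕ,
      ∑ P ∈ (midWalks (stripV (R + 1) (R + 1))).filter
          (fun P => finalDart P = ((d, 0, false), (d, -1, true)) ∨
            finalDart P = ((d, -1, true), (d, 0, false))), hexCriticalFugacity ^ mwLen P ≤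
        (1 + ε) * ∑ P ∈ (midWalks (stripV (N' + 1) (N' + 1))).filter
          (fun P => finalDart P = ((d, 0, false), (d, -1, true)) ∨
            finalDart P = ((d, -1, true), (d, 0, false))), hexCriticalFugacity ^ mwLen P := by
  -- the HexVertex-side sequence at the cell `x = 0`, offset `y = d e₀`
  set x : Site 2 := 0 with hx
  set y : Site 2 := Pi.single 0 d with hy
  have hy1 : y 1 = x 1 := by simp [hy, hx]
  have hyx : y ≠ x := by
    intro h
    have := congrFun h 0
    simp [hy, hx] at this
    exact hd this
  have hd' : y 0 - x 0 = d := by simp [hy, hx]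
  set f : ℕ → ℝ := fun R => ∑ γ : HexMidEdgeSAW ((stripV (R + 1) (R + 1)).map
      (hvIso.trans (shift (-(x 0)) (-(x 1)))).symm.toEquiv.toEmbedding)
      s((x - Pi.single 1 1, 1), (x, 0)) s((y - Pi.single 1 1, 1), (y, 0)),
      hexCriticalFugacity ^ γ.length with hf
  have hmono : Monotone f := by
    refine monotone_nat_of_le_succ fun R => ?_
    exact archMass_mono (halfStrip_mono x (Nat.le_succ R)) _ _
  have hbd : ∀ R, f R ≤ (Real.cos (3 * Real.pi / 8))⁻¹ := fun R =>
    floorArchMass_le _ x y (fun v hv => (halfStrip_geometry hv).1) hy1 hyx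
  have hbdd : BddAbove (range f) := ⟨_, by rintro _ ⟨R, rfl⟩; exact hbd R⟩
  have hf0 : ∀ R, 0 ≤ f R := fun R => archMass_nonneg _ _ _
  -- identification with the coded sums
  have hfe : ∀ R : ℕ, |d| ≤ R + 1 → f R =
      ∑ P ∈ (midWalks (stripV (R + 1) (R + 1))).filter
        (fun P => finalDart P = ((d, 0, false), (d, -1, true)) ∨
          finalDart P = ((d, -1, true), (d, 0, false))), hexCriticalFugacity ^ mwLen P := by
    intro R hR
    rw [hf]
    simp only []
    rw [archMass_halfStrip_eq x y R hy1 (floorUp_mem_halfStrip hy1 (hd'.symm ▸ hR)), hd']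
  -- the monotone limit
  set M := ⨆ R, f R with hM
  have hfM : ∀ R, f R ≤ M := fun R => le_ciSup hbdd R
  have htend : Tendsto f atTop (𝓝 M) := tendsto_atTop_ciSup hmono hbdd
  -- the threshold
  have key : ∃ N : ℕ, ∀ N', N ≤ N' → ∀ R, f R ≤ (1 + ε) * f N' := by
    by_cases hM0 : M ≤ 0
    · refine ⟨0, fun N' _ R => ?_⟩
      have h1 : (0 : ℝ) ≤ (1 + ε) * f N' := mul_nonneg (by linarith) (hf0 N')
      linarith [hfM R]
    · push Not at hM0
      have hlt : M / (1 + ε) < M := div_lt_self hM0 (by linarith)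
      obtain ⟨N, hN⟩ := eventually_atTop.1 (htend.eventually (lt_mem_nhds hlt))
      refine ⟨N, fun N' hN' R => ?_⟩
      have h1 : M / (1 + ε) < f N' := hN N' hN'
      rw [div_lt_iff₀ (by linarith)] at h1
      linarith [hfM R]
  obtain ⟨N, hN⟩ := key
  refine ⟨N, fun N' hN' hdN' R => ?_⟩
  have hR : |d| ≤ max R N' + 1 := hdN'.trans (by push_cast; gcongr; exact le_max_right _ _)
  calc _ ≤ _ := hvArchSum_mono d (le_max_left R N')
    _ = f (max R N') := (hfe _ hR).symm
    _ ≤ (1 + ε) * f N' := hN N' hN' _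
    _ = _ := by rw [hfe N' hdN']

/-- **Registered sub-goal `stub_halfPlaneArchTightness_archThreshold`** (crux item
stmt-CriticalPhenomena-10472, line `floor-ratio-restriction-bootstrap`, anchor stub
`stub_halfPlaneArchTightness`): the tail of the critical half-plane arch series at a fixed offset
`d ≠ 0` — beyond a threshold `N`, every strip `S_{R+1,R+1}` carries at most `(1 + ε)` times the coded
floor-arch mass of `S_{N'+1,N'+1}`, `N' ≥ N` (`exists_archThreshold`).
[cite: DuminilCopinSmirnov2012, Lemma 2 and §3 ("A_T ≤ 1/c_α")] -/
theorem stub_halfPlaneArchTightness_archThreshold :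
    ∀ (d : ℤ), d ≠ 0 → ∀ (ε : ℝ), 0 < ε → ∃ N : ℕ, ∀ N' : ℕ, N ≤ N' → |d| ≤ N' + 1 → ∀ R : ℕ,
      ∑ P ∈ (HV.midWalks (HV.stripV (R + 1) (R + 1))).filter
          (fun P => HV.finalDart P = ((d, 0, false), (d, -1, true)) ∨
            HV.finalDart P = ((d, -1, true), (d, 0, false))), hexCriticalFugacity ^ HV.mwLen P ≤
        (1 + ε) * ∑ P ∈ (HV.midWalks (HV.stripV (N' + 1) (N' + 1))).filter
          (fun P => HV.finalDart P = ((d, 0, false), (d, -1, true)) ∨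
            HV.finalDart P = ((d, -1, true), (d, 0, false))), hexCriticalFugacity ^ HV.mwLen P :=
  fun d hd ε hε => exists_archThreshold d hd ε hε

end Summit.CriticalPhenomena.SAWScalingLimit.Theorems.ObservableToSLE.FloorRatio

end
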